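import Summits.Schanuel.Schanuel.Theorems.ZilberEacFibreGeneric
import Literature.ModelTheory.Zilber.EACPeriodicCylinders
import HarnessLib

/-!
# `y_last`-cylinders lie in the fibred piece: `dim cl[Δ_d](W ∩ Gⁿ) ≤ d`

Zilber's Exponential-Algebraic Closedness, case ladder (host summit Schanuel, cell `pub-schanuel`,
seat 2, gen 5).  Closes the gap between gen 4's torus-ruled reduction (whose residual piece is
"period `e_last` ∧ `W` a `y_last`-cylinder") and the fibred periodic piece of seat 1's split
(`dim cl[Δ_d](W ∩ Gⁿ) = d`): for an irreducible `(d+1)`-fold `W` meeting the torus which is a cylinder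
in `y_last` (`IsCoordCylinder W (inr last)`), `dim cl[Δ_d](W ∩ Gⁿ) ≤ d`
(`zariskiDim_image_dropLastMat_le_of_isCoordCylinder`); with rotundity (`≥ d`) the residual piece is
therefore inside `ECCellPeriodicStdFib d`.

Proof.  At the generic point the coordinate function `y_last` is transcendental over the algebra of
the other coordinates (a polynomial relation would, by the cylinder property, have all its
`y_last`-coefficients in `I(W)`), so that algebra has transcendence degree `≤ dim W - 1 = d`, and it
contains the coordinate algebra `ℂ[s̄]` of `cl[Δ_d](W ∩ Gⁿ)`.

Honest framing: bookkeeping; nothing about `EC(3,2)` (OPEN) or Schanuel's conjecture is asserted.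
-/

noncomputable section

open MvPolynomial
open Literature.NumberTheory.Transcendental Literature.ModelTheory.Zilber

set_option linter.dupNamespace false

universe u

namespace Summit.Schanuel.Schanuel.Theorems

/-! ## `trdeg (F[S]) + 1 ≤ trdeg K` when something is transcendental over `F[S]` -/

/-- If `u` is transcendental over `F[S] ⊆ K` then `trdeg_F F[S] + 1 ≤ trdeg_F K`. [folklore] -/
theorem trdeg_adjoin_add_one_le {F : Type*} {K : Type u} [Field F] [Field K] [Algebra F K]
    (S : Set K) {u : K} (hu : Transcendental (Algebra.adjoin F S) u) :
    Algebra.trdeg F (Algebra.adjoin F S) + 1 ≤ Algebra.trdeg F K := by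
  set A := Algebra.adjoin F S with hA
  haveI : FaithfulSMul F A := (faithfulSMul_iff_algebraMap_injective F A).2 (algebraMap F A).injective
  obtain ⟨s, hs⟩ := exists_isTranscendenceBasis F A
  -- the basis, pushed into `K`, stays independent and lies in `A`
  have hind : AlgebraicIndependent F (fun i : s => ((i : A) : K)) :=
    hs.1.map' (f := A.val) Subtype.val_injective
  have hsub : Set.range (fun i : s => ((i : A) : K)) ⊆ (A : Set K) := by
    rintro _ ⟨i, rfl⟩; exact (i : A).2
  have hle : Algebra.adjoin F (Set.range fun i : s => ((i : A) : K)) ≤ A := Algebra.adjoin_le hsub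
  have hopt : AlgebraicIndependent F (fun o : Option s => o.elim u fun i : s => ((i : A) : K)) :=
    AlgebraicIndependent.option_iff.2 ⟨hind, hu.of_tower_top_of_subalgebra_le hle⟩
  have h1 := hopt.cardinalMk_le_trdeg
  rw [Cardinal.mk_option, hs.cardinalMk_eq_trdeg] at h1
  exact h1

/-! ## The last multiplicative coordinate of a `y_last`-cylinder is transcendental -/

section Cyl

variable {d : ℕ} (P : Ideal (MvPolynomial (Fin (d + 1) ⊕ Fin (d + 1)) ℂ)) [P.IsPrime]

/-- For a `y_last`-cylinder `Z(P)`, a polynomial relation `h(ξ', y_last) = 0` at the generic point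
between `y_last` and the other coordinates has all its coefficients killed: every coefficient,
renamed into `ℂ[X_σ]`, lies in `P`. [folklore] -/
theorem coeff_mem_of_isCoordCylinder
    (hcyl : IsCoordCylinder (zeroLocus ℂ P) (Sum.inr (Fin.last d)))
    (h : Polynomial (MvPolynomial {j : Fin (d + 1) ⊕ Fin (d + 1) // j ≠ Sum.inr (Fin.last d)} ℂ))
    (hh : Polynomial.eval₂ (rename (R := ℂ) (Subtype.val : {j : Fin (d + 1) ⊕ Fin (d + 1) //
        j ≠ Sum.inr (Fin.last d)} → Fin (d + 1) ⊕ Fin (d + 1)) :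
        MvPolynomial _ ℂ →+* MvPolynomial (Fin (d + 1) ⊕ Fin (d + 1)) ℂ)
      (X (Sum.inr (Fin.last d))) h ∈ P) (i : ℕ) :
    rename (R := ℂ) Subtype.val (h.coeff i) ∈ P := by
  haveI : Infinite ℂ := Infinite.of_injective _ Nat.cast_injective
  rw [← MvPolynomial.IsPrime.vanishingIdeal_zeroLocus (K := ℂ) P, mem_vanishingIdeal_iff]
  intro z hz
  -- the one-variable polynomial `t ↦ h(z', t)` vanishes identically
  set q : Polynomial ℂ := h.map (MvPolynomial.eval fun j : {j // j ≠ Sum.inr (Fin.last d)} => z j.1)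
    with hq
  have hzero : ∀ t : ℂ, q.eval t = 0 := by
    intro t
    have hmem := hcyl z hz t
    have := (mem_zeroLocus_iff.1 hmem) _ hh
    change MvPolynomial.eval (Function.update z (Sum.inr (Fin.last d)) t)
      (Polynomial.eval₂ _ (X (Sum.inr (Fin.last d))) h) = 0 at this
    rw [Polynomial.hom_eval₂, MvPolynomial.eval_X, Function.update_self] at this
    have hcomp : (MvPolynomial.eval (Function.update z (Sum.inr (Fin.last d)) t)).comp
        (rename (R := ℂ) (Subtype.val : {j : Fin (d + 1) ⊕ Fin (d + 1) //
          j ≠ Sum.inr (Fin.last d)} → Fin (d + 1) ⊕ Fin (d + 1)) :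
          MvPolynomial _ ℂ →+* MvPolynomial (Fin (d + 1) ⊕ Fin (d + 1)) ℂ) =
        MvPolynomial.eval fun j : {j // j ≠ Sum.inr (Fin.last d)} => z j.1 := by
      refine MvPolynomial.ringHom_ext (fun c => ?_) (fun j => ?_)
      · rw [RingHom.comp_apply, RingHom.coe_coe, rename_C, eval_C, eval_C]
      · rw [RingHom.comp_apply, RingHom.coe_coe, rename_X, eval_X, eval_X, Function.update_of_ne j.2]
    rw [hcomp, ← Polynomial.eval_map] at this
    exact this
  have hq0 : q = 0 := Polynomial.eq_zero_of_infinite_isRoot q (Set.infinite_univ.mono fun t _ => hzero t)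
  have hci : MvPolynomial.eval (fun j : {j // j ≠ Sum.inr (Fin.last d)} => z j.1) (h.coeff i) = 0 := by
    have := congrArg (fun p => p.coeff i) hq0
    simpa only [hq, Polynomial.coeff_map, Polynomial.coeff_zero] using this
  change MvPolynomial.eval z (rename _ (h.coeff i)) = 0
  rw [eval_rename]
  exact hci

/-- **`y_last` is transcendental over the other coordinate functions** of a `y_last`-cylinder.
[folklore] -/
theorem transcendental_genericPt_last_of_isCoordCylinder
    (hcyl : IsCoordCylinder (zeroLocus ℂ P) (Sum.inr (Fin.last d))) :
    Transcendental (Algebra.adjoin ℂ (Set.range fun j : {j : Fin (d + 1) ⊕ Fin (d + 1) //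
        j ≠ Sum.inr (Fin.last d)} => genericPt P j.1)) (genericPt P (Sum.inr (Fin.last d))) := by
  set s : {j : Fin (d + 1) ⊕ Fin (d + 1) // j ≠ Sum.inr (Fin.last d)} → zeroLocusFunctionField P :=
    fun j => genericPt P j.1 with hs
  set B := Algebra.adjoin ℂ (Set.range s) with hB
  rw [transcendental_iff]
  intro f hf
  -- lift the coefficients of `f ∈ B[T]` to polynomials in the other variables
  have hmem : ∀ q : MvPolynomial {j // j ≠ Sum.inr (Fin.last d)} ℂ, MvPolynomial.aeval s q ∈ B :=
    fun q => by rw [hB, Algebra.adjoin_range_eq_range_aeval]; exact ⟨q, rfl⟩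
  let φ : MvPolynomial {j // j ≠ Sum.inr (Fin.last d)} ℂ →+* B :=
    (MvPolynomial.aeval (R := ℂ) s).toRingHom.codRestrict B.toSubring.toSubsemiring hmem
  have hφsurj : Function.Surjective φ := by
    rintro ⟨x, hx⟩
    rw [hB, Algebra.adjoin_range_eq_range_aeval] at hx
    obtain ⟨q, rfl⟩ := hx
    exact ⟨q, rfl⟩
  obtain ⟨h, rfl⟩ := Polynomial.map_surjective φ hφsurj f
  -- the relation `h(ξ', y_last) ∈ P`
  have hrel : Polynomial.eval₂ (rename (R := ℂ) (Subtype.val : {j : Fin (d + 1) ⊕ Fin (d + 1) //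
        j ≠ Sum.inr (Fin.last d)} → Fin (d + 1) ⊕ Fin (d + 1)) :
        MvPolynomial _ ℂ →+* MvPolynomial (Fin (d + 1) ⊕ Fin (d + 1)) ℂ)
      (X (Sum.inr (Fin.last d))) h ∈ P := by
    rw [← (isGenericPt_genericPt P) _]
    have hcomp : ((MvPolynomial.aeval (R := ℂ) (genericPt P) :
        MvPolynomial (Fin (d + 1) ⊕ Fin (d + 1)) ℂ →+* zeroLocusFunctionField P).comp
        (rename (R := ℂ) (Subtype.val : {j : Fin (d + 1) ⊕ Fin (d + 1) //
          j ≠ Sum.inr (Fin.last d)} → Fin (d + 1) ⊕ Fin (d + 1)) :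
          MvPolynomial _ ℂ →+* MvPolynomial (Fin (d + 1) ⊕ Fin (d + 1)) ℂ)) =
        (algebraMap B (zeroLocusFunctionField P)).comp φ := by
      refine MvPolynomial.ringHom_ext (fun c => ?_) (fun j => ?_)
      · rw [RingHom.comp_apply, RingHom.coe_coe, RingHom.coe_coe, rename_C, MvPolynomial.aeval_C]
        change _ = MvPolynomial.aeval (R := ℂ) s (C c)
        rw [MvPolynomial.aeval_C]
      · rw [RingHom.comp_apply, RingHom.coe_coe, RingHom.coe_coe, rename_X, MvPolynomial.aeval_X]
        change _ = MvPolynomial.aeval (R := ℂ) s (X j)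
        rw [MvPolynomial.aeval_X]
    change MvPolynomial.aeval (genericPt P) _ = 0
    rw [← RingHom.coe_coe, Polynomial.hom_eval₂, hcomp, RingHom.coe_coe, MvPolynomial.aeval_X,
      ← Polynomial.eval₂_map]
    exact hf
  -- so every coefficient of `h` is killed, i.e. `h.map φ = 0`
  ext i
  rw [Polynomial.coeff_map, Polynomial.coeff_zero]
  have hci := coeff_mem_of_isCoordCylinder P hcyl h hrel i
  rw [← (isGenericPt_genericPt P) _, aeval_rename] at hci
  change MvPolynomial.aeval (R := ℂ) (genericPt P ∘ Subtype.val) (h.coeff i) =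
    (0 : zeroLocusFunctionField P)
  exact hci

/-- **`y_last`-cylinders have `dim cl[Δ_d](W ∩ Gⁿ) ≤ d`.** [folklore] -/
theorem zariskiDim_image_dropLastMat_le_of_isCoordCylinder
    (hne : (zeroLocus ℂ P ∩ torusLocus ℂ (d + 1)).Nonempty)
    (hdim : zariskiDim ℂ (zeroLocus ℂ P) = (d + 1 : ℕ))
    (hcyl : IsCoordCylinder (zeroLocus ℂ P) (Sum.inr (Fin.last d))) :
    zariskiDim ℂ (matrixAct (dropLastMat d) '' (zeroLocus ℂ P ∩ torusLocus ℂ (d + 1))) ≤ d := by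
  set s : {j : Fin (d + 1) ⊕ Fin (d + 1) // j ≠ Sum.inr (Fin.last d)} → zeroLocusFunctionField P :=
    fun j => genericPt P j.1 with hs
  set B := Algebra.adjoin ℂ (Set.range s) with hB
  -- `trdeg B + 1 ≤ trdeg K = d + 1`
  have hK := trdeg_functionField_eq P hdim
  have h1 := trdeg_adjoin_add_one_le (F := ℂ) (Set.range s)
    (transcendental_genericPt_last_of_isCoordCylinder P hcyl)
  rw [hK, Fintype.card_fin] at h1
  -- the coordinate algebra of `cl[Δ_d]` sits inside `B`
  set A := (MvPolynomial.aeval (R := ℂ) (matrixAct (dropLastMat d) (genericPt P))).range with hA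
  have hAB : A ≤ B := by
    rw [hA, ← Algebra.adjoin_range_eq_range_aeval]
    refine Algebra.adjoin_le ?_
    rintro _ ⟨j, rfl⟩
    rcases j with k | k
    · rcases Fin.eq_castSucc_or_eq_last k with ⟨i, rfl⟩ | rfl
      · rw [matrixAct_dropLastMat_inl, if_neg (Fin.castSucc_ne_last i)]
        exact Algebra.subset_adjoin ⟨⟨Sum.inl (Fin.castSucc i), Sum.inl_ne_inr⟩, rfl⟩
      · rw [matrixAct_dropLastMat_inl_last]; exact B.zero_mem
    · rcases Fin.eq_castSucc_or_eq_last k with ⟨i, rfl⟩ | rfl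
      · rw [matrixAct_dropLastMat_inr, if_neg (Fin.castSucc_ne_last i)]
        exact Algebra.subset_adjoin ⟨⟨Sum.inr (Fin.castSucc i),
          fun h => Fin.castSucc_ne_last i (Sum.inr_injective h)⟩, rfl⟩
      · rw [matrixAct_dropLastMat_inr_last]; exact B.one_mem
  have hAle : Algebra.trdeg ℂ A ≤ Algebra.trdeg ℂ B :=
    trdeg_le_of_injective (Subalgebra.inclusion hAB) (Subalgebra.inclusion_injective hAB)
  -- numerics
  rw [zariskiDim_image_matrixAct_eq P (isGenericPt_genericPt P) hne (dropLastMat d)]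
  haveI : Algebra.FiniteType ℂ A := Algebra.FiniteType.of_surjective _ (AlgHom.rangeRestrict_surjective _)
  have hfinA : Algebra.trdeg ℂ A < Cardinal.aleph0 := trdeg_lt_aleph0
  have hle : Algebra.trdeg ℂ A + 1 ≤ (d : Cardinal) + 1 := by
    calc Algebra.trdeg ℂ A + 1 ≤ Algebra.trdeg ℂ B + 1 := add_le_add hAle le_rfl
      _ ≤ (d : Cardinal) + 1 := by exact_mod_cast h1
  obtain ⟨a, ha⟩ := Cardinal.lt_aleph0.1 hfinA
  rw [ha] at hle ⊢
  rw [Cardinal.toNat_natCast]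
  have : a ≤ d := by
    have h2 : ((a + 1 : ℕ) : Cardinal) ≤ ((d + 1 : ℕ) : Cardinal) := by push_cast; exact hle
    have h3 : a + 1 ≤ d + 1 := by exact_mod_cast h2
    omega
  exact_mod_cast this

end Cyl

end Summit.Schanuel.Schanuel.Theorems
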